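import Literature.AlgebraicGeometry.AbelianSchemes.SerreTensorIdealTranslationKernelScheme
import Literature.AlgebraicGeometry.AbelianSchemes.SerreTensorBaseChange
import HarnessLib

/-!
# Base change of the ideal translation: `(ψ_P)_{S′} = ψ_P` of `A_{S′}` under `(A ⊗_𝒪 𝔟)_{S′} ≅ A_{S′} ⊗_𝒪 𝔟`

Topic `AlgebraicGeometry/AbelianSchemes`, namespace `Literature.AlgebraicGeometry.AbelianSchemes.AbelianSchemeOver` (three typed-carrier wrappers with bodies +
proved theorems; no named fact, no `sorry`, no `instance`, no notation; ANY base change `g : S′ → S`).  Cell `hodgecm-mathlib`, F0/P6 «MOD», sequel (b) of ★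
(A)∕(A′) `SerreTensorIdealTranslationKernel(Scheme)` over ★ FILE 4b `SerreTensorBaseChange` (p844846) and ★ `AbelianSchemeFixedPowBaseChange` (p844808): the
translation `ψ_P : A → A ⊗_𝒪 𝔟` commutes with base change, so its kernel `A[𝔭]` and the identification «`A ⊗ 𝔭⁻¹ = A ⁄ A[𝔭]`» read the same way on
every fibre ∕ at the three levels `Ω ∕ 𝒪_Ω ∕ κ̄` of the P6 datum; `--supports stmt-HodgeConjecture-24832`, count-neutral.  HC_CM is proved only modulo the 2
remaining named inputs (hLiu418, h413) until rung 0 closes; this file discharges none of them.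

## Mathematics

`ψ_P ≫ ι = τ_P = (ι(P_k))_k` (★ `serreTranslate_comp_serreι`), base change is a functor commuting with the coordinate projections (★ `powBC`) and
`ι(a)_{S′} = ι_{S′}(a)` (★ `RingAction.baseChange`); since `ι′ : A_{S′} ⊗ 𝔟 ↪ (A_{S′})ⁿ` is a monomorphism, `(ψ_P)_{S′} ≫ β = ψ_P(A_{S′})` for the
base-change isomorphism `β : (A ⊗ 𝔟)_{S′} ≅ A_{S′} ⊗ 𝔟` (★ `serreTensorBaseChangeIso′`) ([Conrad2004GrossZagier] §7: the Serre construction commutes with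
base change; [GortzWedhorn2020] (4.7)).  As in ★ FILE 4a∕4b the maps are typed on the carriers `(·.baseChange g).X` (definitionally `(Over.pullback g).obj`).

## Contents

* `idealTupleBC` (`(τ_P)_{S′}` on carriers), **`idealTupleBC_comp_powBC`** (`(τ_P)_{S′} ≫ powBC = τ_P` of `A_{S′}`);
* `serreTranslateBC` (`(ψ_P)_{S′}` on carriers), `serreιBC`, `serreTranslateBC_comp_serreιBC`, `serreTensorBaseChangeIso'_hom_serreι`, **`serreTranslateBC_comp_baseChangeIso`** (`(ψ_P)_{S′} ≫ β.hom = ψ_P(A_{S′})`),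
  `serreTranslateBC_eq`.

## References
* [Conrad2004GrossZagier] B. Conrad, *Gross–Zagier revisited*, MSRI Publ. 49 (2004), §7 (Thm. 7.5).
* [GortzWedhorn2020] U. Görtz, T. Wedhorn, *Algebraic Geometry I* (2nd ed.), Section (4.7) (pp. 107–108) (base change).
* Tree: ★ `SerreTensorBaseChange`, ★ `AbelianSchemeFixedPowBaseChange`, ★ `SerreTensorIdealTranslationKernelScheme`.
-/

noncomputable section

universe u

open CategoryTheory CategoryTheory.Limits AlgebraicGeometry MonoidalCategory CartesianMonoidalCategory
open scoped MonObj

namespace Literature.AlgebraicGeometry.AbelianSchemes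

namespace AbelianSchemeOver

variable {S S' : Scheme.{u}} (g : S' ⟶ S) {A : AbelianSchemeOver S} {O : Type*} [CommRing O] (act : A.RingAction O)
  {m : ℕ} (P : Matrix (Fin m) (Fin 1) O)

/-! ## §1 Base change of the tuple map `τ_P` -/

/-- `(τ_P)_{S′} : A_{S′} ⟶ (Aᵐ)_{S′}` (typed on the carriers). [cite: GortzWedhorn2020, Section (4.7) (pp. 107–108)] -/
def idealTupleBC : (A.baseChange g).X ⟶ ((A.pow m).baseChange g).X := (Over.pullback g).map (idealTuple act P)

/-- `(τ_P)_{S′} ≫ (pr_k)_{S′} = ι_{S′}(P_k)`. [cite: GortzWedhorn2020, Section (4.7) (pp. 107–108)] -/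
@[reassoc]
theorem idealTupleBC_powProjBC (k : Fin m) : idealTupleBC g act P ≫ powProjBC g A m k = (act.baseChange g).i (P k 0) := by
  change (Over.pullback g).map (idealTuple act P) ≫ (Over.pullback g).map (A.powProj m k) = (Over.pullback g).map (act.i (P k 0))
  rw [← Functor.map_comp, idealTuple_powProj]

/-- **`(τ_P)_{S′} ≫ powBC = τ_P` of the base-changed action on `A_{S′}`.** [cite: GortzWedhorn2020, Section (4.7) (pp. 107–108)] -/
theorem idealTupleBC_comp_powBC : idealTupleBC g act P ≫ powBC g A m = idealTuple (act.baseChange g) P := by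
  refine pow_hom_ext fun k => ?_
  rw [Category.assoc, powBC_powProj, idealTupleBC_powProjBC, idealTuple_powProj]

/-! ## §2 Base change of `ψ_P` -/

section Translate

variable [IsCommMonObj A.X] (E' : Matrix (Fin m) (Fin m) O) (hE' : E' * E' = E')

/-- `(ψ_P)_{S′} : A_{S′} ⟶ (A ⊗_𝒪 𝔟)_{S′}` (typed on the carriers). [cite: Conrad2004GrossZagier, §7 (Thm. 7.5)] -/
def serreTranslateBC : (A.baseChange g).X ⟶ ((serreTensor act E' hE').baseChange g).X :=
  (Over.pullback g).map (serreTranslate act E' hE' P)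

/-- `ι_{S′} : (A ⊗_𝒪 𝔟)_{S′} ⟶ (Aᵐ)_{S′}` (typed on the Serre-tensor carrier; definitionally ★ `ιBC`). [cite: Conrad2004GrossZagier, §7 (Thm. 7.5)] -/
def serreιBC : ((serreTensor act E' hE').baseChange g).X ⟶ ((A.pow m).baseChange g).X := (Over.pullback g).map (serreι act E' hE')

/-- `(ψ_P)_{S′} ≫ ι_{S′} = (τ_P)_{S′}` (base change of ★ `serreTranslate_comp_serreι`). [cite: Conrad2004GrossZagier, §7 (Thm. 7.5)] -/
theorem serreTranslateBC_comp_serreιBC (hP : E' * P = P) :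
    serreTranslateBC g act P E' hE' ≫ serreιBC g act E' hE' = idealTupleBC g act P := by
  change (Over.pullback g).map (serreTranslate act E' hE' P) ≫ (Over.pullback g).map (serreι act E' hE') =
    (Over.pullback g).map (idealTuple act P)
  rw [← Functor.map_comp, serreTranslate_comp_serreι act E' hE' P hP]

/-- `β.hom ≫ ι′ = ι_{S′} ≫ powBC` (★ `serreTensorBaseChangeIso_hom_ι`, typed on the Serre-tensor carriers). [cite: Conrad2004GrossZagier, §7 (Thm. 7.5)] -/
theorem serreTensorBaseChangeIso'_hom_serreι :
    (serreTensorBaseChangeIso' g act E' hE').hom ≫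
        @serreι S' (A.baseChange g) O _ (act.baseChange g) (isCommMonObj_baseChange g) m E' hE' =
      serreιBC g act E' hE' ≫ powBC g A m :=
  serreTensorBaseChangeIso_hom_ι g act E' hE'

/-- **BASE CHANGE OF THE IDEAL TRANSLATION**: `(ψ_P)_{S′} ≫ β.hom = ψ_P(A_{S′})` for `β : (A ⊗_𝒪 𝔟)_{S′} ≅ A_{S′} ⊗_𝒪 𝔟` (★ `serreTensorBaseChangeIso′`).
[cite: Conrad2004GrossZagier, §7 (Thm. 7.5)] [cite: GortzWedhorn2020, Section (4.7) (pp. 107–108)] -/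
theorem serreTranslateBC_comp_baseChangeIso (hP : E' * P = P) :
    serreTranslateBC g act P E' hE' ≫ (serreTensorBaseChangeIso' g act E' hE').hom =
      @serreTranslate S' (A.baseChange g) O _ (act.baseChange g) (isCommMonObj_baseChange g) m E' hE' P := by
  haveI := isCommMonObj_baseChange g (A := A)
  haveI : Mono (@serreι S' (A.baseChange g) O _ (act.baseChange g) (isCommMonObj_baseChange g) m E' hE') :=
    (isMonHom_serreι_serreπ (act.baseChange g) E' hE').2.2
  rw [← cancel_mono (@serreι S' (A.baseChange g) O _ (act.baseChange g) (isCommMonObj_baseChange g) m E' hE')]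
  -- right-hand side: `ψ' ≫ ι' = τ'`
  have hR : @serreTranslate S' (A.baseChange g) O _ (act.baseChange g) (isCommMonObj_baseChange g) m E' hE' P ≫
      @serreι S' (A.baseChange g) O _ (act.baseChange g) (isCommMonObj_baseChange g) m E' hE' =
      idealTuple (act.baseChange g) P :=
    serreTranslate_comp_serreι (act.baseChange g) E' hE' P hP
  -- left-hand side: `ψ_{S'} ≫ β ≫ ι' = ψ_{S'} ≫ ι_{S'} ≫ powBC = τ_{S'} ≫ powBC = τ'`
  rw [Category.assoc, serreTensorBaseChangeIso'_hom_serreι, ← Category.assoc, serreTranslateBC_comp_serreιBC g act P E' hE' hP,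
    idealTupleBC_comp_powBC, hR]

/-- The same as an equation for `(ψ_P)_{S′}`: `(ψ_P)_{S′} = ψ_P(A_{S′}) ≫ β.inv`. [cite: Conrad2004GrossZagier, §7 (Thm. 7.5)] -/
theorem serreTranslateBC_eq (hP : E' * P = P) :
    serreTranslateBC g act P E' hE' =
      @serreTranslate S' (A.baseChange g) O _ (act.baseChange g) (isCommMonObj_baseChange g) m E' hE' P ≫
        (serreTensorBaseChangeIso' g act E' hE').inv := by
  rw [← serreTranslateBC_comp_baseChangeIso g act P E' hE' hP, Category.assoc, Iso.hom_inv_id, Category.comp_id]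

end Translate

end AbelianSchemeOver

end Literature.AlgebraicGeometry.AbelianSchemes

end
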